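import Summits.QuantumFields.BalabanUV.T4Continuum.Support.B13TermContours
import Summits.QuantumFields.BalabanUV.T4Continuum.Spine.NE1p.DressedSmallFieldShape
import Summits.QuantumFields.BalabanUV.T4Continuum.Spine.NE1p.DressedSmallFieldInductionWitness

/-!
# T⁴ programme, spine estimate NE1′ (node O3b/H2) — WITNESS W29: THE CAUCHY LETTER OF (2.14) IS (B1)'s SHAPE, BY THEOREM — print's
# per-polymer interpolation pair `t(Y), τ(Y)` (the NE5 substrate's checked contour objects `B13TermContours`, BY NAME) reproduces the MAYER
# FACTOR `e^{𝐕(Y)} − 1` as ONE (2.14)-shape term of `DressedSmallFieldShape` (owner node N0k); the product over a finite polymer family is ONE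
# term over the product contour space; N0k's END FIRES on W23's two-cube catalogue with a represented activity that is GENUINELY NONLINEAR
# in a GENUINE table

Cell `pub-balaban`, sub-cell `t4`, row NE1′ formalisation crew (`t4/formal/NE1p/LEAVES.md` row W29 ∕ DAG N29zg; own-initiative witness under typer
R-T61 (ii), INTENT journal l.15830, BOOKED R-T103 (v) l.15907), unit `b2b-balaban-t4-ne1p-formalise-leaf-08` (gen 8).  ADDITIVE — imports `Support/B13TermContours` (NE5 formalisation crew,
unit `b2b-balaban-t4-ne5-formalise-leaf-08`, p215612: the one-variable contour space `lam₁ = dt|_{[0,1]} ⊗ dθ|_{[0,2π]}`, the Cauchy weight `w₁ r`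
with `‖w₁ r p‖ ≤ wB₁ r`, the circle point `circ r θ`, the dictionary check `integral_w₁_mul_eq_sub : ∫ w₁ r p·F(circ r p.2) dlam₁ = F 1 − F 0`,
and the finite products `lamJ`∕`wJ`∕`wBJ`∕`sigmaJ` — a CROSS-ROW BY-NAME use; if that Support file changes, this file rebuilds),
`Spine/NE1p/DressedSmallFieldShape` (owner N0k, p220184) and `Spine/NE1p/DressedSmallFieldInductionWitness` (crew W25, p222160; through it W23's
two-cube catalogue `DressedSmallFieldPencilWitness`) ONLY; DATA `def`s + theorems; 0 `def … : Prop`, 0 cite, 0 sorry.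

WHY THIS FILE.  N0k's small-field ENDs carry the displayed binder (B1) `hrep : act s Z = Σ_{j ∈ terms Z} ∫ pre_j(ω)·exp(ℓ_{j,ω}(V s)) dν_j(ω)`
— the (2.14)-SHAPE of a dressed activity read along the table curve `V` ([Balaban1988RGII] (2.14) p. 15 «exp[Σ_{Y∈𝐃} τ(Y)𝐕_k(Y,B)]», each
`τ(Y)` on the circle of its (2.18) radius, p. 16 — TYPE∕CONTEXT only).  In the tree `hrep` has so far been inhabited only by `rfl` on activities
DEFINED as such an integral (N0k §5, N0l §3: Dirac parameter measures; W27: a Gaussian term by construction).  Here it is a THEOREM about an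
activity given in CLOSED FORM as a NONLINEAR function of the table: for print's per-polymer interpolation pair `t(Y), τ(Y)` — in kernel the
substrate's `(lam₁, w₁ r, circ r)` — and ANY evaluation functional `e` on ANY table space,
`∫ w₁ r p · exp((circ r p.2)·e(Q)) dlam₁(p) = e^{e(Q)} − 1` (§1, `cauchyLetter_rep`): THE MAYER FACTOR of the table entry `e(Q)` IS one
(2.14)-shape term, with a DIFFUSE parameter measure, a contour-valued functional `ℓ_ω = τ(ω)•e` of CONSTANT bound `r·‖e‖`, and the (2.15)
majorant in closed form `≤ r∕(r−1)²·e^{κ}` at exponent `κ` (§1, `majorant_C_le`; `2π·wB₁ r = r∕(r−1)²`).  Print's «Σ_{Y∈𝐃}»: the PRODUCT of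
Mayer factors over a finite family `J` is ONE term over the substrate's product space (§2, `mayerProduct_rep`, Fubini).  §3: N0k's END
`muPart_locE_le_of_linearDressing` FIRES ONCE BY NAME on W23's two-cube catalogue with the GENUINE table space `Pol → ℂ` (evaluation
functionals `ev Z`), the linearly dressed table `V₀M + s•OM` and the represented MAYER ACTIVITY `actM s Z = cM Z·(e^{(V₀M + s•OM) Z} − 1)`, whose
`hrep` is §1's theorem; §4: the activity is NOT affine in the source and the μ-part is NOT zero; §5: print's radius–size trade-off as
arithmetic — at contour radius = inverse size the letter costs `≤ 4e·(size)`.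

WHAT IS AND IS NOT NEW.  New: the first NE1′ ↔ NE5-substrate link at the level of (2.14)'s letters; `hrep` as an identity for a nonlinear
closed-form activity; the contour parameter in `ω`; the product-over-𝐃 face.  NOT new ∕ NOT touched: the substrate's objects and its dictionary
check (cited BY NAME, not restated); W23's catalogue and sockets; W25's liveness identity `exp_locE_univ`; N0k's ENDs.  NOT exercised: (2.14)'s
Gaussian `dμ_C`, characteristic functions, `Γ_k`, the cube letters `s(Δ), σ(Δ)`, the `(𝐔,𝐉)`-analyticity — ONE letter of (2.14) only.

HONEST FRAMING.  A DECIDED TOY plus [folklore] complex analysis (Cauchy's formula through the substrate's checked dictionary, Fubini) inhabit N0k's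
hypothesis SHAPES; the identification of `e`∕`Pot` with `𝐕_k(Y,B)` and of `J` with `𝐃` is the owner's READING (memo g26 (R3)∕§5 (f)) exercised on
the substrate's CONTOUR OBJECTS, not on Bałaban's densities; (B1) for Bałaban's (2.14) is NOT discharged; `hL3` ((B3), GAPS G-ne9p2-5, UNPRINTED)
is toy-true here BY CHOICE of `cM`; (B5) untouched against print's numbers; the numerals `r = 2`, `ε₁ = b₀ = 1∕8`, `μ₁ = 1`, `R₀ = 1∕4` are the
TOY's — k2: no numeral of (2.18) asserted; §5's `4·e` is OUR arithmetic on OUR majorant shape, not a constant of print, and «radius ∝ size⁻¹» is a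
TYPE reading of (2.18)'s `1∕|τ(Y)|`, not its statement; `hrep_M` being a THEOREM discharges N0k's `hrep` FOR THIS TOY ACTIVITY ONLY (typer R-T103 (v)
wording (h)); discharges no wall item; R-t4r2-Q2 NOT met thereby; NE1′ ⇐ the named binders — NOT proved, NOT printed; spine PROVED 0∕9; count 9
unchanged.  Rung (B)+1 on ONE finite four-torus — NOT infinite volume, NOT a mass gap, NOT OS on ℝ⁴, NOT Clay.  HONEST DEPENDENCY:
continuum YM on T⁴ ⇐ BetaPertH ∧ nine spine estimates (0/9 proved); BetaPertH ⇐ (D1) ∧ (D4) ∧ CAP+tail; G-an2-4 gates asym, D1 and NE2/3/4.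
-/

noncomputable section

namespace Summit.QuantumFields.BalabanUV.T4Continuum.NE1p.DressedSmallFieldContourWitness

open MeasureTheory Metric Set Complex Finset
open scoped BigOperators Function
open Summit.QuantumFields.BalabanUV.T4Continuum.B13TermContours
open Literature.MathematicalPhysics.QuantumFieldTheory.Balaban1983to89.B13Resummation (locE)
open Literature.Probability.LatticeModels (polyInc)
open Summit.QuantumFields.BalabanUV.T4Continuum.NE1p.DressedSmallFieldShape (muPart_locE_le_of_linearDressing)
open Summit.QuantumFields.BalabanUV.T4Continuum.NE1p.DressedSmallFieldPencilWitness
  (Pol cubes₂ d₂ m₂ m₂_nonneg hloc₂ hd₂ h126₂ hvol₂ h227₂ hsmall₂ envelope₂_eq)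
open Summit.QuantumFields.BalabanUV.T4Continuum.NE1p.DressedSmallFieldInductionWitness (exp_locE_univ)
open DressedSmallFieldPencilWitness.Pol

variable {Pot : Type*} [NormedAddCommGroup Pot] [NormedSpace ℂ Pot]

/-! ## §1 ONE CAUCHY LETTER = ONE (2.14)-SHAPE TERM: parameter `ω = (t, θ)`, measure `lam₁`, prefactor `w₁ r`, functional `(circ r θ) • e` -/

/-- THE CONTOUR FUNCTIONAL of one letter: at parameter `p = (t, θ)` the functional `ℓ_p := τ(p) • e` with `τ(p) = circ r θ` ON the circle of
radius `r` (print's `τ(Y)` times «evaluate the table at `Y`», TYPE) — its operator-norm bound `r·‖e‖` is CONSTANT in `ω`. -/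
def linC (r : ℝ) (e : Pot →L[ℂ] ℂ) (p : ℝ × ℝ) : Pot →L[ℂ] ℂ := (circ r p.2) • e

/-- `linC r e p Q = circ r θ · e Q`. [folklore] -/
@[simp] theorem linC_apply (r : ℝ) (e : Pot →L[ℂ] ℂ) (p : ℝ × ℝ) (Q : Pot) : linC r e p Q = circ r p.2 * e Q := rfl

/-- Socket `hl` of N0k for the Cauchy letter, WITH EQUALITY: `‖linC r e p‖ = r·‖e‖` (the contour value has modulus `r`). [folklore] -/
theorem norm_linC_eq {r : ℝ} (hr : 0 ≤ r) (e : Pot →L[ℂ] ℂ) (p : ℝ × ℝ) : ‖linC r e p‖ = r * ‖e‖ := by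
  unfold linC; rw [norm_smul, norm_circ hr]

/-- Socket `hpre` of N0k for the Cauchy letter: the Cauchy weight is (a.e.-strongly) measurable (substrate `measurable_w₁`). [folklore] -/
theorem hpre_C (r : ℝ) : AEStronglyMeasurable (w₁ r) lam₁ := (measurable_w₁ r).aestronglyMeasurable

/-- Socket `hlinw` of N0k for the Cauchy letter: `p ↦ ℓ_p Q` is measurable (substrate `measurable_circ`). [folklore] -/
theorem hlinw_C (r : ℝ) (e : Pot →L[ℂ] ℂ) (Q : Pot) : AEStronglyMeasurable (fun p => linC r e p Q) lam₁ :=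
  (((measurable_circ r).comp measurable_snd).mul_const (e Q)).aestronglyMeasurable

/-- The total mass of the one-letter parameter space: `lam₁(univ) = 1·2π`. [folklore] -/
theorem lam₁_univ : lam₁ Set.univ = ENNReal.ofReal (2 * Real.pi) := by
  rw [lam₁, ← Set.univ_prod_univ, Measure.prod_prod, Measure.restrict_apply_univ, Measure.restrict_apply_univ, Real.volume_Icc,
    Real.volume_Icc, sub_zero, sub_zero, ENNReal.ofReal_one, one_mul]

/-- `∫ c dlam₁ = 2π·c`. [folklore] -/
theorem integral_const_lam₁ (c : ℝ) : ∫ _p, c ∂lam₁ = 2 * Real.pi * c := by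
  rw [integral_const, smul_eq_mul, measureReal_def, lam₁_univ, ENNReal.toReal_ofReal (by positivity)]

/-- Socket `hint` of N0k for the Cauchy letter at ANY exponent `κ` (in N0k, `κ = l·R₀` with the dressed radius `R₀`): a bounded weight on a
finite measure. [folklore] -/
theorem hint_C {r : ℝ} (hr : 1 < r) (κ : ℝ) : Integrable (fun p => ‖w₁ r p‖ * Real.exp κ) lam₁ :=
  Integrable.mono' (integrable_const (wB₁ r * Real.exp κ)) ((measurable_w₁ r).norm.aestronglyMeasurable.mul aestronglyMeasurable_const)
    (Filter.Eventually.of_forall fun p => by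
      rw [Real.norm_of_nonneg (by positivity)]; exact mul_le_mul_of_nonneg_right (norm_w₁_le hr p) (Real.exp_pos κ).le)

/-- **THE CAUCHY LETTER OF (2.14) IS ONE (2.14)-SHAPE TERM — N0k's `hrep` AS AN IDENTITY** (kernel; the substrate's dictionary check
`B13TermContours.integral_w₁_mul_eq_sub` BY NAME at the entire function `τ ↦ e^{τ·e(Q)}`): for every table space `Pot`, functional `e`,
radius `r > 1` and table `Q`, `∫ w₁ r p · exp(ℓ_p Q) dlam₁(p) = e^{e(Q)} − 1` — the MAYER FACTOR of the entry `e(Q)`, a genuinely NONLINEAR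
function of the table, in the averaged exp-linear shape with μ-free data `(lam₁, w₁ r, (circ r ·) • e)`. -/
theorem cauchyLetter_rep {r : ℝ} (hr : 1 < r) (e : Pot →L[ℂ] ℂ) (Q : Pot) :
    ∫ p, w₁ r p * cexp (linC r e p Q) ∂lam₁ = cexp (e Q) - 1 := by
  have h := integral_w₁_mul_eq_sub hr isOpen_univ (Set.subset_univ _) (F := fun τ => cexp (τ * e Q))
    ((differentiable_id.mul_const _).cexp.differentiableOn)
  simp only [one_mul, zero_mul, Complex.exp_zero] at h
  simpa only [linC_apply] using h

/-- **THE (2.15)-MAJORANT OF THE CAUCHY LETTER IN CLOSED FORM** (kernel): `∫ ‖w₁ r p‖·e^{κ} dlam₁ ≤ r∕(r − 1)²·e^{κ}` — the substrate's weight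
letter `wB₁ r = (2π)⁻¹((r−1)²)⁻¹ r` times the mass `2π` (print's prefactor per polymer in (2.15), TYPE; the exponent `κ = r·‖e‖·R₀` is the
contour radius times the size of the entry at the dressed radius). -/
theorem majorant_C_le {r : ℝ} (hr : 1 < r) (κ : ℝ) : ∫ p, ‖w₁ r p‖ * Real.exp κ ∂lam₁ ≤ r / (r - 1) ^ 2 * Real.exp κ := by
  have hπ : Real.pi ≠ 0 := Real.pi_pos.ne'
  have hr1 : (r - 1) ^ 2 ≠ 0 := by positivity
  calc ∫ p, ‖w₁ r p‖ * Real.exp κ ∂lam₁ ≤ ∫ _p, wB₁ r * Real.exp κ ∂lam₁ :=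
        integral_mono (hint_C hr κ) (integrable_const _) fun p => mul_le_mul_of_nonneg_right (norm_w₁_le hr p) (Real.exp_pos κ).le
    _ = r / (r - 1) ^ 2 * Real.exp κ := by rw [integral_const_lam₁, wB₁]; field_simp

/-! ## §2 THE MAYER PRODUCT OVER A FINITE POLYMER FAMILY `J` (print's «Σ_{Y∈𝐃} τ(Y)𝐕_k(Y,B)», TYPE) IS ONE TERM over `lamJ J`, `wJ r` -/

section Product

variable {J : Type*} [Fintype J]

/-- THE PRODUCT CONTOUR FUNCTIONAL `ℓ_p := Σ_j σ_j(p) • e_j` (one contour value per polymer of the family, substrate `sigmaJ`). -/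
def linJ (r : J → ℝ) (e : J → (Pot →L[ℂ] ℂ)) (p : J → ℝ × ℝ) : Pot →L[ℂ] ℂ := ∑ j, (sigmaJ r p j) • e j

/-- `linJ r e p Q = Σ_j σ_j(p)·e_j(Q)`. [folklore] -/
theorem linJ_apply (r : J → ℝ) (e : J → (Pot →L[ℂ] ℂ)) (p : J → ℝ × ℝ) (Q : Pot) : linJ r e p Q = ∑ j, sigmaJ r p j * e j Q := by
  simp only [linJ, _root_.sum_apply, smul_apply, smul_eq_mul]

/-- Socket `hl` for the product letter: `‖linJ r e p‖ ≤ Σ_j r_j·‖e_j‖`, CONSTANT in `ω`. [folklore] -/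
theorem norm_linJ_le {r : J → ℝ} (hr : ∀ j, 0 ≤ r j) (e : J → (Pot →L[ℂ] ℂ)) (p : J → ℝ × ℝ) : ‖linJ r e p‖ ≤ ∑ j, r j * ‖e j‖ :=
  (norm_sum_le _ _).trans (Finset.sum_le_sum fun j _ => by rw [norm_smul, norm_sigmaJ hr p j])

/-- Socket `hlinw` for the product letter. [folklore] -/
theorem hlinw_J (r : J → ℝ) (e : J → (Pot →L[ℂ] ℂ)) (Q : Pot) : AEStronglyMeasurable (fun p => linJ r e p Q) (lamJ J) := by
  simp_rw [linJ_apply]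
  exact (Finset.measurable_sum _ fun j _ => (measurable_sigmaJ r j).mul_const (e j Q)).aestronglyMeasurable

/-- Socket `hint` for the product letter at any exponent: the product weight is bounded (`norm_wJ_le`) on the finite measure `lamJ J`. [folklore] -/
theorem hint_J {r : J → ℝ} (hr : ∀ j, 1 < r j) (κ : ℝ) : Integrable (fun p => ‖wJ r p‖ * Real.exp κ) (lamJ J) :=
  Integrable.mono' (integrable_const (wBJ r * Real.exp κ)) ((measurable_wJ r).norm.aestronglyMeasurable.mul aestronglyMeasurable_const)
    (Filter.Eventually.of_forall fun p => by
      rw [Real.norm_of_nonneg (by positivity)]; exact mul_le_mul_of_nonneg_right (norm_wJ_le hr p) (Real.exp_pos κ).le)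

/-- **THE MAYER PRODUCT IS ONE (2.14)-SHAPE TERM** (kernel; Mathlib's Fubini `integral_fintype_prod_eq_prod` on the substrate's product space +
§1's identity per variable): for radii `r_j > 1`, `∫ wJ r p · exp(Σ_j σ_j(p)·e_j(Q)) dlamJ(p) = Π_j (e^{e_j(Q)} − 1)` — the product over the
polymer family of the Mayer factors of the table entries, with μ-free data `(lamJ J, wJ r, linJ r e)`. -/
theorem mayerProduct_rep {r : J → ℝ} (hr : ∀ j, 1 < r j) (e : J → (Pot →L[ℂ] ℂ)) (Q : Pot) :
    ∫ p, wJ r p * cexp (linJ r e p Q) ∂lamJ J = ∏ j, (cexp (e j Q) - 1) := by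
  have h1 : ∀ p : J → ℝ × ℝ, wJ r p * cexp (linJ r e p Q) = ∏ j, (w₁ (r j) (p j) * cexp (circ (r j) (p j).2 * e j Q)) := by
    intro p
    rw [linJ_apply, Complex.exp_sum, wJ, ← Finset.prod_mul_distrib]; rfl
  simp_rw [h1]
  rw [lamJ, MeasureTheory.integral_fintype_prod_eq_prod (𝕜 := ℂ) (fun j (x : ℝ × ℝ) => w₁ (r j) x * cexp (circ (r j) x.2 * e j Q))]
  refine Finset.prod_congr rfl fun j _ => ?_
  have h := integral_w₁_mul_eq_sub (hr j) isOpen_univ (Set.subset_univ _) (F := fun τ => cexp (τ * e j Q))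
    ((differentiable_id.mul_const _).cexp.differentiableOn)
  simpa only [one_mul, zero_mul, Complex.exp_zero] using h

end Product

/-! ## §3 THE END FIRES: N0k `muPart_locE_le_of_linearDressing` on W23's two-cube catalogue with the Mayer activity of a GENUINE table -/

/-- Evaluation of a table `Q : Pol → ℂ` at the polymer `Z` as a continuous linear functional («𝐕 ↦ 𝐕(Y)», TYPE). -/
def ev (Z : Pol) : (Pol → ℂ) →L[ℂ] ℂ := ContinuousLinearMap.proj Z

/-- `ev Z Q = Q Z`. [folklore] -/
@[simp] theorem ev_apply (Z : Pol) (Q : Pol → ℂ) : ev Z Q = Q Z := rfl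

/-- `‖ev Z‖ ≤ 1` (sup norm). [folklore] -/
theorem norm_ev_le (Z : Pol) : ‖ev Z‖ ≤ 1 :=
  ContinuousLinearMap.opNorm_le_bound _ zero_le_one fun Q => by rw [one_mul]; exact norm_le_pi_norm Q Z

/-- The observable's table, REAL letters: supported on the pair polymer, `oR p01 = 1∕8`, `oR p0 = oR p1 = 0`. -/
def oR : Pol → ℝ
  | p01 => 1 / 8
  | _ => 0

/-- The undressed table `V₀M ≡ 1∕8` (size `ε₁ = 1∕8`). -/
def V₀M : Pol → ℂ := fun _ => ((1 / 8 : ℝ) : ℂ)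

/-- The observable's table `OM Z = oR Z` (size `b₀ = 1∕8`). -/
def OM : Pol → ℂ := fun Z => (oR Z : ℂ)

/-- `0 ≤ oR Z ≤ 1∕8`. [folklore] -/
theorem oR_mem (Z : Pol) : 0 ≤ oR Z ∧ oR Z ≤ 1 / 8 := by cases Z <;> norm_num [oR]

/-- Socket `hV₀` : `‖V₀M‖ ≤ ε₁ = 1∕8`. [folklore] -/
theorem norm_V₀M_le : ‖V₀M‖ ≤ 1 / 8 :=
  (pi_norm_le_iff_of_nonneg (by norm_num)).2 fun Z => by rw [V₀M, Complex.norm_real, Real.norm_of_nonneg (by norm_num)]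

/-- Socket `hO` : `‖OM‖ ≤ b₀ = 1∕8`. [folklore] -/
theorem norm_OM_le : ‖OM‖ ≤ 1 / 8 :=
  (pi_norm_le_iff_of_nonneg (by norm_num)).2 fun Z => by rw [OM, Complex.norm_real, Real.norm_of_nonneg (oR_mem Z).1]; exact (oR_mem Z).2

/-- The located prefactor `cM Z := m Z∕(2·e^{1∕2})` (W23's `m Z = (1∕12)e^{−5 d Z}`), chosen so that `hL3` holds at W23's `A = 1∕12`, `R = 5`
with EQUALITY — the (2.38)-shape is toy-true BY CHOICE of `cM`, not (2.38) for any dressed activity. -/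
def cM (Z : Pol) : ℝ := m₂ Z / (2 * Real.exp (1 / 2))

/-- `0 < cM Z`. [folklore] -/
theorem cM_pos (Z : Pol) : 0 < cM Z := by unfold cM m₂; positivity

/-- The prefactor of the Mayer letter of polymer `Z`: `cM Z` times the Cauchy weight at contour radius `r = 2`. -/
def preM (Z : Pol) (p : ℝ × ℝ) : ℂ := (cM Z : ℂ) * w₁ 2 p

/-- THE MAYER ACTIVITY of the dressed table: `actM s Z := cM Z·(e^{(V₀M + s•OM) Z} − 1)` — given in CLOSED FORM, nonlinear in the table. -/
def actM (s : ℂ) (Z : Pol) : ℂ := (cM Z : ℂ) * (cexp ((V₀M + s • OM) Z) - 1)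

/-- `‖preM Z p‖ ≤ cM Z·wB₁ 2`. [folklore] -/
theorem norm_preM_le (Z : Pol) (p : ℝ × ℝ) : ‖preM Z p‖ ≤ cM Z * wB₁ 2 := by
  rw [preM, norm_mul, Complex.norm_real, Real.norm_of_nonneg (cM_pos Z).le]
  exact mul_le_mul_of_nonneg_left (norm_w₁_le one_lt_two p) (cM_pos Z).le

/-- Socket `hpre` for the Mayer letters. [folklore] -/
theorem hpre_M (Z : Pol) : AEStronglyMeasurable (preM Z) lam₁ := (measurable_const.mul (measurable_w₁ 2)).aestronglyMeasurable

/-- Socket `hint` for the Mayer letters at any exponent. [folklore] -/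
theorem hint_M (Z : Pol) (κ : ℝ) : Integrable (fun p => ‖preM Z p‖ * Real.exp κ) lam₁ :=
  Integrable.mono' (integrable_const (cM Z * wB₁ 2 * Real.exp κ)) ((hpre_M Z).norm.mul aestronglyMeasurable_const)
    (Filter.Eventually.of_forall fun p => by
      rw [Real.norm_of_nonneg (by positivity)]; exact mul_le_mul_of_nonneg_right (norm_preM_le Z p) (Real.exp_pos κ).le)

/-- Socket `hl` for the Mayer letters: `‖linC 2 (ev Z) p‖ ≤ 2`. [folklore] -/
theorem hl_M (Z : Pol) (p : ℝ × ℝ) : ‖linC 2 (ev Z) p‖ ≤ 2 := by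
  rw [norm_linC_eq zero_le_two]; linarith [norm_ev_le Z, mul_le_mul_of_nonneg_left (norm_ev_le Z) zero_le_two]

/-- **(B1) `hrep` FOR THE MAYER ACTIVITY IS A THEOREM** (§1 `cauchyLetter_rep` at `e = ev Z`, `r = 2`, one term per polymer): at EVERY source
`s`, `actM s Z = Σ_{j∈{Z}} ∫ preM j p · exp(ℓ_{j,p}(V₀M + s•OM)) dlam₁(p)` — N0k's displayed shape, inhabited by Cauchy's formula, not by `rfl`. -/
theorem hrep_M (s : ℂ) (Z : Pol) :
    actM s Z = ∑ j ∈ ({Z} : Finset Pol), ∫ p, preM j p * cexp (linC 2 (ev j) p (V₀M + s • OM)) ∂lam₁ := by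
  rw [Finset.sum_singleton]
  simp_rw [preM, mul_assoc]
  rw [integral_const_mul, cauchyLetter_rep one_lt_two, ev_apply, actM]

/-- Socket `hL3` — the (2.38)-SHAPE at W23's `A = 1∕12`, `R = 5`, dressed radius `ε₁ + μ₁b₀ = 1∕8 + 1·(1∕8)`, functional bound `2`: by §1's
closed-form majorant, `Σ_{j∈{Z}} ∫‖preM j‖e^{2·(1∕4)} ≤ cM Z·2·e^{1∕2} = m Z` — toy-true BY CHOICE of `cM`. -/
theorem hL3_M : ∀ Z : Pol, cubes₂ Z ⊆ univ →
    ∑ j ∈ ({Z} : Finset Pol), ∫ p, ‖preM j p‖ * Real.exp (2 * (1 / 8 + 1 * (1 / 8))) ∂lam₁ ≤ 1 / 12 * Real.exp (-(5 * d₂ Z)) := by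
  intro Z _
  rw [Finset.sum_singleton]
  have hκ : (2 : ℝ) * (1 / 8 + 1 * (1 / 8)) = 1 / 2 := by norm_num
  have h1 : ∀ p, ‖preM Z p‖ * Real.exp (2 * (1 / 8 + 1 * (1 / 8))) = cM Z * (‖w₁ 2 p‖ * Real.exp (1 / 2)) := fun p => by
    rw [hκ, preM, norm_mul, Complex.norm_real, Real.norm_of_nonneg (cM_pos Z).le, mul_assoc]
  simp_rw [h1]
  rw [integral_const_mul]
  calc cM Z * ∫ p, ‖w₁ 2 p‖ * Real.exp (1 / 2) ∂lam₁ ≤ cM Z * (2 / (2 - 1) ^ 2 * Real.exp (1 / 2)) :=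
        mul_le_mul_of_nonneg_left (majorant_C_le one_lt_two _) (cM_pos Z).le
    _ = 1 / 12 * Real.exp (-(5 * d₂ Z)) := by rw [cM, m₂]; field_simp; ring

/-- **N0k's END `muPart_locE_le_of_linearDressing` FIRES WITH A REPRESENTED MAYER ACTIVITY** (ONE application BY NAME; W23's geometry ∕ clause
sockets BY NAME; `hrep` = `hrep_M`, a theorem): source radius `μ₁ = 1`, for `0 < μ₀ < 1`, `‖μ‖ ≤ μ₀`,
`‖E_μ(univ) − E_0(univ)‖ ≤ e·1·1·(3∕2)²·(1∕12)·e^{−1·1}·μ₀∕(1 − μ₀)`. -/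
theorem muPart_fires_M {μ₀ : ℝ} {μ : ℂ} (h0 : 0 < μ₀) (h01 : μ₀ < 1) (hμ : ‖μ‖ ≤ μ₀) :
    ‖locE (polyInc on cubes₂) cubes₂ (actM μ) univ - locE (polyInc on cubes₂) cubes₂ (actM 0) univ‖ ≤
      Real.exp 1 * 1 * 1 * (3 / 2) ^ 2 * (1 / 12) * Real.exp (-(1 * 1)) * (μ₀ / (1 - μ₀)) :=
  muPart_locE_le_of_linearDressing (polyInc on cubes₂) (reach := cubes₂) (d := d₂) (ν' := fun _ => lam₁) (pre := preM)
    (lin := fun Z p => linC 2 (ev Z) p) (l := fun _ _ => 2) (V₀ := V₀M) (O := OM) (terms := fun Z => {Z}) (act := actM) (A := 1 / 12)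
    (R := 5) (r₁ := 1) (κ₀ := 1) (K₀ := 3 / 2) (c₁ := 1) (c := 1) (b := 1) (ν := 1) (dX := 1) (μ₁ := 1) (ε₁ := 1 / 8) (b₀ := 1 / 8)
    hloc₂ (fun Z => by rw [one_mul]) hd₂ (by norm_num) (by norm_num) (by norm_num) (by norm_num) (by norm_num) (by norm_num) (by norm_num)
    (by norm_num) h126₂ hvol₂ h227₂ (by norm_num) hsmall₂ univ_nonempty (fun s _ Z => hrep_M s Z) hpre_M (fun Z Q => hlinw_C 2 (ev Z) Q)
    hl_M (fun Z => hint_M Z _) norm_V₀M_le norm_OM_le (by norm_num) hL3_M h0 h01 hμ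

/-- The same END in closed numerals (W23's `envelope₂_eq`): `‖E_μ(univ) − E_0(univ)‖ ≤ (3∕16)·μ₀∕(1 − μ₀)`. -/
theorem muPart_fires_M' {μ₀ : ℝ} {μ : ℂ} (h0 : 0 < μ₀) (h01 : μ₀ < 1) (hμ : ‖μ‖ ≤ μ₀) :
    ‖locE (polyInc on cubes₂) cubes₂ (actM μ) univ - locE (polyInc on cubes₂) cubes₂ (actM 0) univ‖ ≤ 3 / 16 * (μ₀ / (1 - μ₀)) := by
  rw [← envelope₂_eq]; exact muPart_fires_M h0 h01 hμ

/-! ## §4 GENUINE: the represented activity is NOT affine in the source, and the μ-part is NOT zero -/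

/-- The Mayer activity at a REAL source, as a real number: `vM μ Z = cM Z·(e^{1∕8 + μ·oR Z} − 1)`. -/
def vM (μ : ℝ) (Z : Pol) : ℝ := cM Z * (Real.exp (1 / 8 + μ * oR Z) - 1)

/-- At a real source the Mayer activity is the real number `vM μ Z`. [folklore] -/
theorem actM_ofReal (μ : ℝ) : actM (μ : ℂ) = fun Z => ((vM μ Z : ℝ) : ℂ) := by
  funext Z
  simp only [actM, vM, V₀M, OM, Pi.add_apply, Pi.smul_apply, smul_eq_mul]
  push_cast
  ring

/-- `0 ≤ vM μ Z` for `0 ≤ μ` (the exponent is `≥ 1∕8 > 0`). [folklore] -/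
theorem vM_nonneg {μ : ℝ} (hμ : 0 ≤ μ) (Z : Pol) : 0 ≤ vM μ Z :=
  mul_nonneg (cM_pos Z).le (by have := (oR_mem Z).1; linarith [Real.add_one_le_exp (1 / 8 + μ * oR Z), mul_nonneg hμ this])

/-- **THE REPRESENTED ACTIVITY IS NOT AFFINE IN THE SOURCE** (so this `hrep` is not the Dirac∕linear toy's): its second difference at step `8`
on the pair polymer is `cM p01·e^{1∕8}·(e − 1)² ≠ 0`. -/
theorem actM_not_affine : ¬ ∃ α β : ℂ, ∀ s : ℂ, actM s p01 = α + s * β := by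
  rintro ⟨α, β, h⟩
  have h0 := congrFun (actM_ofReal 0) p01; have h8 := congrFun (actM_ofReal 8) p01; have h16 := congrFun (actM_ofReal 16) p01
  push_cast at h0 h8 h16
  have key : ((vM 16 p01 - 2 * vM 8 p01 + vM 0 p01 : ℝ) : ℂ) = 0 := by
    push_cast; rw [← h0, ← h8, ← h16, h 0, h 8, h 16]; ring
  rw [Complex.ofReal_eq_zero] at key
  have e : vM 16 p01 - 2 * vM 8 p01 + vM 0 p01 = cM p01 * Real.exp (1 / 8) * (Real.exp 1 - 1) ^ 2 := by
    simp only [vM, oR]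
    have h2 : Real.exp (1 / 8 + 16 * (1 / 8)) = Real.exp (1 / 8) * (Real.exp 1) ^ 2 := by
      rw [show (1 : ℝ) / 8 + 16 * (1 / 8) = 1 / 8 + (1 + 1) by norm_num, Real.exp_add, Real.exp_add, sq]
    have h3 : Real.exp (1 / 8 + 8 * (1 / 8)) = Real.exp (1 / 8) * Real.exp 1 := by
      rw [show (1 : ℝ) / 8 + 8 * (1 / 8) = 1 / 8 + 1 by norm_num, Real.exp_add]
    rw [h2, h3, zero_mul, add_zero]; ring
  rw [e] at key
  have hne : (Real.exp 1 - 1) ^ 2 ≠ 0 := pow_ne_zero _ (sub_ne_zero.2 (by have := Real.add_one_le_exp (1 : ℝ); linarith))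
  exact hne ((mul_eq_zero.1 key).resolve_left (mul_ne_zero (cM_pos p01).ne' (Real.exp_pos _).ne'))

/-- **THE μ-PART IS NOT ZERO** (END level; W25's identity `exp_locE_univ` BY NAME on the real nonnegative table `vM μ`): for a real source
`0 < μ` the small-field output at `univ` MOVES — the singleton activities are μ-free (the observable's table vanishes there) and the pair's Mayer
activity `cM p01·(e^{1∕8+μ∕8} − 1)` is strictly increasing in `μ`. -/
theorem locE_live_M {μ : ℝ} (hμ : 0 < μ) :
    locE (polyInc on cubes₂) cubes₂ (actM μ) univ ≠ locE (polyInc on cubes₂) cubes₂ (actM 0) univ := by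
  intro h
  have h' := congrArg Complex.exp h
  rw [← Complex.ofReal_zero, actM_ofReal μ, actM_ofReal 0, exp_locE_univ (vM_nonneg hμ.le), exp_locE_univ (vM_nonneg le_rfl),
    Complex.ofReal_inj] at h'
  have ha0 : vM μ p0 = vM 0 p0 := by simp [vM, oR]
  have ha1 : vM μ p1 = vM 0 p1 := by simp [vM, oR]
  rw [ha0, ha1] at h'
  have hpos : 0 < (1 + vM 0 p0) * (1 + vM 0 p1) := by
    have := vM_nonneg le_rfl p0; have := vM_nonneg le_rfl p1; positivity
  rw [div_left_inj' hpos.ne', add_right_inj] at h'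
  have h2 : Real.exp (1 / 8 + μ * oR p01) = Real.exp (1 / 8 + 0 * oR p01) := by
    have := mul_left_cancel₀ (cM_pos p01).ne' h'; linarith
  rw [Real.exp_eq_exp] at h2
  norm_num [oR] at h2
  exact hμ.ne' h2

/-! ## §5 PRINT'S RADIUS–SIZE TRADE-OFF AS ARITHMETIC: at contour radius = inverse size the Cauchy letter costs `O(size)` -/

/-- **THE MAYER LETTER COSTS `≤ 4e·(size)` AT CONTOUR RADIUS = INVERSE SIZE** [arith]: §1's majorant `r∕(r−1)²·e^{r·x}` (with `x = ‖e‖·R₀`,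
the size of the entry at the dressed radius) evaluated at `r = 1∕x`, `0 < x ≤ 1∕2`, is `x·e∕(1−x)² ≤ 4e·x` — (2.18)'s «radius ∝ (size)⁻¹»
read as arithmetic (TYPE; the `4e` is this file's, no constant of print asserted). -/
theorem majorant_at_inverse_size {x : ℝ} (hx : 0 < x) (hx2 : x ≤ 1 / 2) :
    (1 / x) / (1 / x - 1) ^ 2 * Real.exp (1 / x * x) ≤ 4 * Real.exp 1 * x := by
  have hx0 : x ≠ 0 := hx.ne'
  have h1 : 1 / x * x = 1 := by field_simp
  have h2 : (1 / x) / (1 / x - 1) ^ 2 = x / (1 - x) ^ 2 := by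
    have hx1 : 1 - x ≠ 0 := by linarith
    field_simp
  rw [h1, h2]
  have hq : 1 / 4 ≤ (1 - x) ^ 2 := by nlinarith
  calc x / (1 - x) ^ 2 * Real.exp 1 ≤ x / (1 / 4) * Real.exp 1 := by gcongr
    _ = 4 * Real.exp 1 * x := by ring

end Summit.QuantumFields.BalabanUV.T4Continuum.NE1p.DressedSmallFieldContourWitness

end
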